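import Literature.Probability.Percolation.SharpnessDCTProofs
import Literature.Probability.Percolation.MeanFieldBetaFromGamma
import Literature.Probability.Percolation.LongRangeVolumeTailBootstrap
import HarnessLib

/-!
# `stub_volumeTail_mono` — the volume tail `P_u(|C(0)| ≥ n)` on `ℤ³` is non-decreasing in the level `u`

Crux `Summit.CriticalPhenomena.PercolationContinuityZ3.Theses.PercMinContact.TwoArmWindow`
(item stmt-CriticalPhenomena-11499), line `registered`, registered stub `stub_volumeTail_mono` of the
lead's skeleton (`--supports stmt-CriticalPhenomena-11499`): the monotonicity glue of engine (b), which
transports the exponential volume tail from one fixed subcritical level down to every smaller level.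

Statement: for all levels `u ≤ v` in `[0, 1]` and every `n`,
`P_u(|C(0)| ≥ n) ≤ P_v(|C(0)| ≥ n)` for bond percolation on `ℤ³`.

Proof (every ingredient is PROVED in the tree). The event `{ω | n ≤ |C_ω(0)|}` is by definition
`clusterSizeGe (0 : Site 3) n`; it is increasing (enlarging the set of open edges enlarges the open
cluster, `isUpperSet_clusterSizeGe`) and measurable (`measurableSet_clusterSizeGe`), so the monotone
coupling `DCT16.real_mono_of_isUpperSet` (Grimmett 1999, Thm. 2.1) gives `P_u ≤ P_v` on it.
-/

noncomputable section

namespace Summit.CriticalPhenomena.PercolationContinuityZ3.Theorems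

open MeasureTheory Literature.Probability.Percolation Literature.Probability.LatticeModels

/-- **`stub_volumeTail_mono` — MONOTONICITY OF THE VOLUME TAIL IN THE LEVEL, KNOWN.**  For all levels
`u ≤ v` and every `n`, `P_u(|C(0)| ≥ n) ≤ P_v(|C(0)| ≥ n)` on `ℤ³`: the event `{|C(0)| ≥ n}`
(`clusterSizeGe 0 n`) is increasing (`isUpperSet_clusterSizeGe`) and measurable
(`measurableSet_clusterSizeGe`), and `P_p(A)` is non-decreasing in `p` for every increasing measurable
`A` by the monotone coupling (`DCT16.real_mono_of_isUpperSet`, Grimmett 1999, Thm. 2.1). -/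
theorem stub_volumeTail_mono :
    ∀ u v : unitInterval, u ≤ v → ∀ n : ℕ,
      (bondPercolation (zdGraph 3) u).real {ω | (n : ℕ∞) ≤ (openCluster ω 0).encard} ≤
        (bondPercolation (zdGraph 3) v).real {ω | (n : ℕ∞) ≤ (openCluster ω 0).encard} := by
  intro u v huv n
  show (bondPercolation (zdGraph 3) u).real (clusterSizeGe (0 : Site 3) n) ≤
    (bondPercolation (zdGraph 3) v).real (clusterSizeGe (0 : Site 3) n)
  exact DCT16.real_mono_of_isUpperSet (zdGraph 3) (isUpperSet_clusterSizeGe 0 n)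
    (measurableSet_clusterSizeGe 0 n) huv

end Summit.CriticalPhenomena.PercolationContinuityZ3.Theorems

end
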